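import Summits.ValiantsHypothesis.ValiantsHypothesis.Theorems.KPlusLogSqLawTropicalBThreeRowEightDefs
import Summits.ValiantsHypothesis.ValiantsHypothesis.Theorems.KPlusLogSqLawTropicalBSplitDefs

/-!
# Route «KPlusLogSqLaw», crux `TropicalB` (stmt-ValiantsHypothesis-19771) — the `m = 3` tropical row for ALL `K`:
# a self-similar `3 × 3` family with EIGHT uniquely dominant terms per class level, `T_unsigned(3,K) ≥ 8K − 33`

HONEST FRAMING.  Helper file (cell `pub-symmetroid`, seat val-sym-trop-p3 (g5), 2026-08-27) for the registered stubs of the OPEN crux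
`TropicalB`.  A SMALL-FORMAT row (size `m = 3`, every `K`) in the super-fat corner `K ≫ m`; nothing here bears on `TropicalB` in its
window, `WeakLifting`, the doors, `MatrixDescartes` (stmt-ValiantsHypothesis-18050) or VP ≠ VNP; a row FLOOR refutes no law of record.

THE FAMILY (closed form, all `K ≥ 5`).  Exponents on the rail `d_l = 4^l`; valuations
`v(a,b,l) = (ψ(a,b) + 1536·l − 512)·4^l` for the eight PRESENT cells `(a,b) ≠ (0,2)` (the entry `(0,2)` is absent: `ε(0,2,·) = 0`, so the
two Leibniz lines through it never compete), phases `ψ = ((206, 3269, ·), (−208, 914, 3643), (−187, 972, 5589))`; slopes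
`θ_k = 6144 + 192·k`.  Writing `k = 8q + j` (level `ℓ = q + 4`, phase `j`), the `k`-th dominant term is the template
`T₂(ℓ;ℓ−3,ℓ−4) R²(ℓ;ℓ−3,ℓ−3) R²(ℓ;ℓ−2,ℓ−3) R²(ℓ;ℓ−2,ℓ−2) T₀(ℓ;ℓ−1,ℓ−2) D(ℓ;ℓ,ℓ−4) D(ℓ;ℓ,ℓ−3) T₀(ℓ;ℓ,ℓ−2)` (classes per column; `T₂ = (0 1)`,
`R² = col ↦ row (2,0,1)`, `T₀ = (1 2)`, `D = id`).  WHY IT WORKS FOR EVERY `K` (the proof below): at slope `θ_k` the value of the port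
`(a,b,l)` is `(A − 1536·l)·4^l` with `A = 6656 + 192k − ψ(a,b)`; `l ↦ (A − 1536 l)4^l` is UNIMODAL (`G_lt_of_lt`, `G_lt_of_gt`) with its peak at
the phase-locked class `q + rs j a b`, and the peak value is `4^q · gsc j a b` — so one level up every value is multiplied by `4`
(SELF-SIMILARITY), and dominance at every level reduces to ONE finite table check per phase: integer potentials `4^q·mu j`, `4^q·nu j`
(the tree's dual certificate `TropicalCensus.isDominant_of_scaledPotential`, scale `4`) dominate the eight peak values, tightly exactly on the
template's cells (`tab_tight`, `tab_slack`, by `decide`).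

DATA in `…TropicalBThreeRowEightDefs` (namespace `ThreeRowEight`).  RESULTS.  `threeRowEight_chain (K') :` an explicit design of format `(3, K'+5)` with a chain of `8(K'+1)` consecutive-distinct uniquely
dominant terms at strictly increasing integer slopes; hence **`not_tropRowD_three (K') : ¬ TropRowD 3 (K'+5) (8·K' + 6)`**, i.e. the
UNSIGNED `(3,K)` row is at least `8K − 33` for every `K ≥ 5` (`TropRowD` = the cell's unsigned row, `…TropicalBSplitDefs`).  Located
context (this seat, not kernel here): the signed row along the same word is also `8` per level (a periodic sign pattern exists), a denser
word gives `10` per level unsigned / `9` signed at `K = 9, 10` (`…ThreeRowTen`), and the kernel ceilings are `18K − 53` / `⌊(27K−17)/2⌋`.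

[this seat's construction (LP search + closed form); the rows are the cell's definitions; no citation exists]
-/

set_option linter.dupNamespace false
set_option autoImplicit false

namespace Summit.ValiantsHypothesis.ValiantsHypothesis.Theorems.KPlusLogSqLaw

open Summit.ValiantsHypothesis.ValiantsHypothesis.Theorems.MatrixDescartes.Negative
open Summit.ValiantsHypothesis.ValiantsHypothesis.Theorems.LacunarySymmetroidMatrixDescartes.TropicalCensus

namespace ThreeRowEight

/-! ## 1. The unimodal profile `G A l = (A − 1536 l)·4^l` -/

/-- one step of the profile. [elementary] -/
theorem G_succ (A : ℤ) (l : ℕ) : G A (l + 1) - G A l = 3 * 4 ^ l * (A - 1536 * (l : ℤ) - 2048) := by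
  unfold G; push_cast; ring

/-- below the peak the profile strictly increases. [elementary] -/
theorem G_lt_of_lt (A : ℤ) (p : ℕ) (hA : 512 + 1536 * (p : ℤ) < A) :
    ∀ l : ℕ, l < p → G A l < G A p := by
  intro l hl
  -- induction on the distance to the peak
  obtain ⟨t, rfl⟩ : ∃ t, p = l + 1 + t := ⟨p - l - 1, by omega⟩
  induction t with
  | zero =>
    have h := G_succ A l
    have hpos : (0 : ℤ) < 3 * 4 ^ l * (A - 1536 * (l : ℤ) - 2048) := by
      have h4 : (0 : ℤ) < 4 ^ l := by positivity
      have : (0 : ℤ) < A - 1536 * (l : ℤ) - 2048 := by push_cast at hA; omega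
      positivity
    simp only [Nat.add_zero] at *
    linarith
  | succ t ih =>
    have hA' : 512 + 1536 * ((l + 1 + t : ℕ) : ℤ) < A := by push_cast at hA ⊢; omega
    have h1 := ih hA' (by omega)
    have h := G_succ A (l + 1 + t)
    have hpos : (0 : ℤ) < 3 * 4 ^ (l + 1 + t) * (A - 1536 * ((l + 1 + t : ℕ) : ℤ) - 2048) := by
      have h4 : (0 : ℤ) < 4 ^ (l + 1 + t) := by positivity
      have : (0 : ℤ) < A - 1536 * ((l + 1 + t : ℕ) : ℤ) - 2048 := by push_cast at hA ⊢; omega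
      positivity
    have : l + 1 + (t + 1) = l + 1 + t + 1 := by omega
    rw [this]
    linarith

/-- above the peak the profile strictly decreases. [elementary] -/
theorem G_lt_of_gt (A : ℤ) (p : ℕ) (hA : A < 2048 + 1536 * (p : ℤ)) :
    ∀ l : ℕ, p < l → G A l < G A p := by
  intro l hl
  obtain ⟨t, rfl⟩ : ∃ t, l = p + 1 + t := ⟨l - p - 1, by omega⟩
  induction t with
  | zero =>
    have h := G_succ A p
    have hneg : 3 * 4 ^ p * (A - 1536 * (p : ℤ) - 2048) < 0 := by
      have h4 : (0 : ℤ) < 4 ^ p := by positivity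
      have : A - 1536 * (p : ℤ) - 2048 < 0 := by omega
      nlinarith
    simp only [Nat.add_zero] at *
    linarith
  | succ t ih =>
    have h1 := ih (by omega)
    have h := G_succ A (p + 1 + t)
    have hneg : 3 * 4 ^ (p + 1 + t) * (A - 1536 * ((p + 1 + t : ℕ) : ℤ) - 2048) < 0 := by
      have h4 : (0 : ℤ) < 4 ^ (p + 1 + t) := by positivity
      have : A - 1536 * ((p + 1 + t : ℕ) : ℤ) - 2048 < 0 := by push_cast; omega
      nlinarith
    have : p + 1 + (t + 1) = p + 1 + t + 1 := by omega
    rw [this]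
    linarith

/-- the profile is dominated by its peak, strictly off the peak. [elementary] -/
theorem G_le_peak (A : ℤ) (p : ℕ) (h1 : 512 + 1536 * (p : ℤ) < A) (h2 : A < 2048 + 1536 * (p : ℤ)) (l : ℕ) :
    G A l ≤ G A p ∧ (l ≠ p → G A l < G A p) := by
  rcases lt_trichotomy l p with h | h | h
  · exact ⟨(G_lt_of_lt A p h1 l h).le, fun _ => G_lt_of_lt A p h1 l h⟩
  · subst h; exact ⟨le_rfl, fun h => (h rfl).elim⟩
  · exact ⟨(G_lt_of_gt A p h2 l h).le, fun _ => G_lt_of_gt A p h2 l h⟩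

/-! ## 2. The data of the family -/

/-! ## 3. The finite tables (checked by `decide`) -/

/-- peak condition for the present cells (ℓ-independent). -/
theorem tab_peak : ∀ (j : Fin 8) (a b : Fin 3), ¬ (a = 0 ∧ b = 2) →
    512 + 1536 * (rs j a b : ℤ) < 6656 + 192 * ((j : ℕ) : ℤ) - psi a b ∧
      6656 + 192 * ((j : ℕ) : ℤ) - psi a b < 2048 + 1536 * (rs j a b : ℤ) := by decide

/-- the template's cells sit on their peaks. -/
theorem tab_co : ∀ (j : Fin 8) (b : Fin 3), rs j (sg j b) b = co j b := by decide

/-- the template's cells are present. -/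
theorem tab_pres : ∀ (j : Fin 8) (b : Fin 3), ¬ (sg j b = 0 ∧ b = 2) := by decide

/-- potentials are tight on the template's cells. -/
theorem tab_tight : ∀ (j : Fin 8) (b : Fin 3), mu j (sg j b) + nu j b = 4 * gsc j (sg j b) b := by decide

/-- potentials strictly dominate every other present cell's peak. -/
theorem tab_slack : ∀ (j : Fin 8) (a b : Fin 3), ¬ (a = 0 ∧ b = 2) → sg j b ≠ a → 4 * gsc j a b < mu j a + nu j b := by decide

/-- consecutive phases are distinct terms (permutation or a class offset changes), including the wrap `7 → 0`. -/
theorem tab_next : ∀ (j : Fin 8), (j : ℕ) < 7 →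
    sg j ≠ sg (j + 1) ∨ ∃ b : Fin 3, co j b ≠ co (j + 1) b := by decide

/-- the wrap `7 → 0` changes the permutation. -/
theorem tab_wrap : sg 7 ≠ sg 0 := by decide

/-! ## 4. The chain -/

/-- the port value at slope `th k` is the profile `G` with `A = 6656 + 192 k − ψ`. -/
theorem value_eq (K' : ℕ) (k : ℕ) (a b : Fin 3) (l : Fin (K' + 5)) :
    th k * (dd (K' + 5) l : ℤ) - vv (K' + 5) a b l = G (6656 + 192 * (k : ℤ) - psi a b) (l : ℕ) := by
  unfold th dd vv G; push_cast; ring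

/-- the peak value at level `q + 4` is `4^q` times the scaled peak. -/
theorem peak_eq (q : ℕ) (j : Fin 8) (a b : Fin 3) :
    G (6656 + 192 * ((8 * q + (j : ℕ) : ℕ) : ℤ) - psi a b) (q + rs j a b) = 4 ^ q * gsc j a b := by
  unfold G gsc; push_cast; rw [pow_add]; ring

/-- **Dominance of the `k`-th term** (all levels at once, by the scaled potentials `4^q·mu`, `4^q·nu`). -/
theorem dominant (K' : ℕ) (k : ℕ) (hk : k / 8 ≤ K') :
    IsDominant (dd (K' + 5)) (vv (K' + 5)) (ee (K' + 5)) (th k) (sg (ph k), cl K' k hk) := by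
  set q := k / 8 with hq
  set j : Fin 8 := ph k with hj
  have hkq : (k : ℤ) = 8 * (q : ℤ) + ((j : ℕ) : ℤ) := by
    have : k = 8 * q + (j : ℕ) := by simp [hq, hj, ph]; omega
    exact_mod_cast this
  have hA : ∀ a b : Fin 3, (6656 + 192 * (k : ℤ) - psi a b) = 6656 + 192 * ((8 * q + (j : ℕ) : ℕ) : ℤ) - psi a b := by
    intro a b; push_cast; rw [hkq]
  refine isDominant_of_scaledPotential (dd (K' + 5)) (vv (K' + 5)) (ee (K' + 5)) (th k) (sg j) (cl K' k hk) 4 (by norm_num)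
    (fun a => 4 ^ q * mu j a) (fun b => 4 ^ q * nu j b) ?_ ?_ ?_
  · -- presence of the template's ports
    intro i
    have := tab_pres j i
    simp only [ee]
    rw [if_neg this]; norm_num
  · -- tightness on the template's ports
    intro i
    have hv := value_eq K' k (sg j i) i (cl K' k hk i)
    have hcl : ((cl K' k hk i : Fin (K' + 5)) : ℕ) = q + rs j (sg j i) i := by
      rw [tab_co j i]; rfl
    rw [hcl, hA, peak_eq] at hv
    have ht := tab_tight j i
    calc 4 ^ q * mu j (sg j i) + 4 ^ q * nu j i = 4 ^ q * (mu j (sg j i) + nu j i) := by ring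
      _ = 4 ^ q * (4 * gsc j (sg j i) i) := by rw [ht]
      _ = 4 * (4 ^ q * gsc j (sg j i) i) := by ring
      _ = 4 * (th k * (dd (K' + 5) (cl K' k hk i) : ℤ) - vv (K' + 5) (sg j i) i (cl K' k hk i)) := by rw [hv]
  · -- strict slack on every other present port
    intro a b l hpres hne
    have hab : ¬ (a = 0 ∧ b = 2) := by
      intro h; apply hpres; simp only [ee]; rw [if_pos h]
    have hv := value_eq K' k a b l
    obtain ⟨h1, h2⟩ := tab_peak j a b hab
    have h1' : 512 + 1536 * ((q + rs j a b : ℕ) : ℤ) < 6656 + 192 * (k : ℤ) - psi a b := by push_cast; rw [hkq]; linarith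
    have h2' : 6656 + 192 * (k : ℤ) - psi a b < 2048 + 1536 * ((q + rs j a b : ℕ) : ℤ) := by push_cast; rw [hkq]; linarith
    obtain ⟨hle, hlt⟩ := G_le_peak (6656 + 192 * (k : ℤ) - psi a b) (q + rs j a b) h1' h2' (l : ℕ)
    have hpk : G (6656 + 192 * (k : ℤ) - psi a b) (q + rs j a b) = 4 ^ q * gsc j a b := by rw [hA, peak_eq]
    have h4q : (0 : ℤ) < 4 ^ q := by positivity
    rw [hv]
    by_cases hsa : sg j b = a
    · -- the template's own cell: then the class differs, so the profile is strictly below its peak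
      subst hsa
      have hl : (l : ℕ) ≠ q + rs j (sg j b) b := by
        intro hl
        rcases hne with hne | hne
        · exact hne rfl
        · apply hne
          apply Fin.ext
          change k / 8 + co (ph k) b = (l : ℕ)
          rw [hl, tab_co j b]
      have hs := hlt hl
      have ht := tab_tight j b
      calc 4 * G (6656 + 192 * (k : ℤ) - psi (sg j b) b) (l : ℕ)
          < 4 * G (6656 + 192 * (k : ℤ) - psi (sg j b) b) (q + rs j (sg j b) b) := by linarith
        _ = 4 ^ q * (4 * gsc j (sg j b) b) := by rw [hpk]; ring
        _ = 4 ^ q * (mu j (sg j b) + nu j b) := by rw [ht]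
        _ = 4 ^ q * mu j (sg j b) + 4 ^ q * nu j b := by ring
    · have hs := tab_slack j a b hab hsa
      calc 4 * G (6656 + 192 * (k : ℤ) - psi a b) (l : ℕ)
          ≤ 4 * G (6656 + 192 * (k : ℤ) - psi a b) (q + rs j a b) := by linarith
        _ = 4 ^ q * (4 * gsc j a b) := by rw [hpk]; ring
        _ < 4 ^ q * (mu j a + nu j b) := mul_lt_mul_of_pos_left hs h4q
        _ = 4 ^ q * mu j a + 4 ^ q * nu j b := by ring

/-- consecutive terms of the chain are distinct. -/
theorem succ_ne (K' : ℕ) (k : ℕ) (hk : k / 8 ≤ K') (hk' : (k + 1) / 8 ≤ K') :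
    (sg (ph k), cl K' k hk) ≠ (sg (ph (k + 1)), cl K' (k + 1) hk') := by
  intro h
  have h1 : sg (ph k) = sg (ph (k + 1)) := congrArg Prod.fst h
  have h2 : cl K' k hk = cl K' (k + 1) hk' := congrArg Prod.snd h
  by_cases h7 : k % 8 < 7
  · -- same level, next phase
    have hph : ph (k + 1) = ph k + 1 := by
      apply Fin.ext; simp only [ph, Fin.val_add]; omega
    have hdiv : (k + 1) / 8 = k / 8 := by omega
    rcases tab_next (ph k) (by simpa [ph] using h7) with hs | ⟨b, hb⟩
    · exact hs (by rw [h1, hph])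
    · apply hb
      have := congrArg (fun f => ((f b : Fin (K' + 5)) : ℕ)) h2
      simpa [cl, hdiv, hph] using this
  · -- wrap to the next level: phases 7 and 0 carry different permutations
    have h7' : k % 8 = 7 := by omega
    have hph0 : ph (k + 1) = 0 := by apply Fin.ext; simp [ph]; omega
    have hph7 : ph k = 7 := by apply Fin.ext; simp [ph]; omega
    rw [hph0, hph7] at h1
    exact tab_wrap h1

/-- **The chain**: for every `K'`, an explicit design of format `(3, K'+5)` with `8(K'+1)` consecutive-distinct uniquely dominant terms at
strictly increasing integer slopes (eight per class level `4 … K'+4`). -/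
theorem threeRowEight_chain (K' : ℕ) :
    ∃ (d : Fin (K' + 5) → ℕ) (v ε : Fin 3 → Fin 3 → Fin (K' + 5) → ℤ), (∀ i j l, (ε i j l).natAbs ≤ 1) ∧
      ∃ (θ : Fin (8 * K' + 7 + 1) → ℤ) (p : Fin (8 * K' + 7 + 1) → Equiv.Perm (Fin 3) × (Fin 3 → Fin (K' + 5))),
        StrictMono θ ∧ (∀ k, IsDominant d v ε (θ k) (p k)) ∧ ∀ k : Fin (8 * K' + 7), p k.castSucc ≠ p k.succ := by
  have hkK : ∀ k : Fin (8 * K' + 7 + 1), (k : ℕ) / 8 ≤ K' := fun k => by have := k.isLt; omega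
  refine ⟨dd (K' + 5), vv (K' + 5), ee (K' + 5), ?_, fun k => th k, fun k => (sg (ph k), cl K' k (hkK k)), ?_, ?_, ?_⟩
  · intro i j l; simp only [ee]; split_ifs <;> simp
  · intro a b hab
    simp only [th]
    have : (a : ℕ) < (b : ℕ) := hab
    omega
  · intro k; exact dominant K' k (hkK k)
  · intro k
    exact succ_ne K' k (hkK k.castSucc) (by have := k.isLt; simp; omega)

end ThreeRowEight

/-- **The unsigned `(3,K)` row is at least `8K − 33` for every `K ≥ 5`:** `¬ TropRowD 3 (K'+5) (8K'+6)`. -/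
theorem not_tropRowD_three (K' : ℕ) : ¬ TropRowD 3 (K' + 5) (8 * K' + 6) := by
  intro h
  obtain ⟨d, v, ε, _, θ, p, hθ, hdom, hne⟩ := ThreeRowEight.threeRowEight_chain K'
  have := h d v ε (8 * K' + 7) θ p hθ hdom hne
  omega

end Summit.ValiantsHypothesis.ValiantsHypothesis.Theorems.KPlusLogSqLaw
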